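import Summits.BirchSwinnertonDyer.Rank1Residual.Additive.QuadraticBranchMazurTateThreeTerm
import HarnessLib

/-!
# The quadratic-branch Mazur–Tate limit: `M ∈ Λ = ℤ_p⟦T⟧` with
# `θ_{2m+1}(f, η) ≡ (−1)^{m+1} ω⁺_{2m+1} M (mod ω_{2m+1} Λ)` for every `m` (proofs only), file 3 of 5
# towards the EXISTENCE of Kobayashi's `L_p⁻(V, η, X)`

HONEST FRAMING (cell `bsd-potss`, run/shared/lean/pub/bsd-potss/, FULL-BSD rank ≤ 1 programme
tranche 1b, human ruling D-0036; seat `bsd-potss-ctrl` = "signed control along the quadratic branch"):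
the programme's target of record is FULL BSD for every analytic-rank ≤ 1 curve over `ℚ`; this seat's
object is the quadratic (`η = ω^{(p−1)/2}`) branch of Kobayashi's signed theory for the good
`a_p = 0` twin `V` of an additive potentially supersingular curve `W = V ⊗ η` (classes Gss2 / O5 `e = 2`,
O10-PS). THIS FILE: THEOREMS ONLY (no definition, no `sorry`); NOTHING about `BSD(W, p)`, (C1_η), (C2_η-GZ) or (C3_η) of any pair is claimed
or moved; no named Literature fact is introduced; axioms standard.

## Contents

* `exists_map_eq_map_quadraticBranchMazurTateElement`: `θ_n(η) ∈ ℤ_p[T]` (`η(w) = ±1`, the symbols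
  `[a/p^k]^δ_f` are `p`-integral for odd `p`, `p ∤ N`, `a_p = 0`).
* `exists_isCongrModOmega_quadraticBranch_odd`: the limit `M = lim_m (−1)^{m+1} θ_{2m+1}(η)/ω⁺_{2m+1}`
  in `Λ = lim Λ/(T ω⁻_{2m+1})` (the tree's `exists_powerSeries_sub_eq_mul`, Lang Ch. 5 §1 Thm. 1.1),
  with the congruences `θ_{2m+1}(η) − (−1)^{m+1} ω⁺_{2m+1} M ∈ ω_{2m+1} Λ` (no `p` inverted;
  `IsCongrModOmega` with exponent `0`). Port of the tree's `exists_isCongrModOmega_odd`; Kobayashi's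
  `L_p⁻(E, η, X)` is `M` up to the period normalisation (file 5).

References: [Kobayashi2003] Thm. 3.2, (3.5) (p. 7); [Pollack2003] Thm. 5.6, Prop. 6.18;
[Lang1990] Ch. 5 §1 Thm. 1.1.
-/

noncomputable section

open scoped Classical MatrixGroups ModularForm

open CongruenceSubgroup Polynomial Literature.NumberTheory.EllipticCurves
  Literature.NumberTheory.EllipticCurves.ModularForms

namespace Summit.BirchSwinnertonDyer.Rank1Residual.Additive

/-! ## §5 Integrality and the construction of `L⁻_η` -/

section Construction

variable {N : ℕ} [NeZero N] {f : CuspForm (Gamma0 N) 2} {p : ℕ} [Fact p.Prime]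

/-- **`θ_n(η) ∈ ℤ_p[T]`**: its image in `ℚ_p[T]` lifts to `ℤ_p[T]` (`η(w) = ±1` and the symbols
`[a/p^k]^δ_f` are `p`-integral for odd `p`, `p ∤ N`, `a_p = 0`). [cite: Pollack2003, Thm. 5.6] -/
theorem exists_map_eq_map_quadraticBranchMazurTateElement (hp2 : p ≠ 2) (hf0 : IsNewform0 f)
    (hQ : coeffField f = ⊥) (hpN : ¬ p ∣ N) (hap : cuspCoeff f p = ((0 : ℤ) : ℂ)) (n : ℕ) :
    ∃ Θ : ℤ_[p][X], Θ.map (algebraMap ℤ_[p] ℚ_[p]) =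
      (quadraticBranchMazurTateElement p f n).map (algebraMap ℚ ℚ_[p]) := by
  classical
  haveI := neZero_torsionOrder p
  haveI := Fintype.ofFinite (rootsOfUnity (torsionOrder p) ℤ_[p])
  rw [← Polynomial.mem_lifts, quadraticBranchMazurTateElement, finsum_eq_sum_of_fintype,
    Polynomial.map_sum]
  refine Subsemiring.sum_mem _ fun w _ ↦ ?_
  rw [Polynomial.map_sum]
  refine Subsemiring.sum_mem _ fun s _ ↦ ?_
  rw [Polynomial.map_mul, Polynomial.map_pow, Polynomial.map_add, Polynomial.map_X,
    Polynomial.map_one, Polynomial.map_C]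
  refine Subsemiring.mul_mem _ ?_ (Subsemiring.pow_mem _
    (Subsemiring.add_mem _ (X_mem_lifts _) (Subsemiring.one_mem _)) _)
  set q : ℚ := branchSymbol p f
    (((PadicInt.toZModPow (n + cyclotomicExponent p) ((w : ℤ_[p]ˣ) : ℤ_[p]) *
        (cyclotomicGenerator p : ZMod (p ^ (n + cyclotomicExponent p))) ^ s.val).val : ℚ) /
      (p : ℚ) ^ (n + cyclotomicExponent p)) with hq
  have hnorm : ‖(q : ℚ_[p])‖ ≤ 1 := norm_branchSymbol_div_pow_le_one hp2 hf0 hQ hpN hap _ _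
  have hsgn : ‖(((teichSign p w : ℤ) : ℚ) : ℚ_[p])‖ ≤ 1 := by
    rw [Rat.cast_intCast]; exact Padic.norm_int_le_one _
  have hnorm' : ‖(((teichSign p w : ℚ) * q : ℚ) : ℚ_[p])‖ ≤ 1 := by
    rw [Rat.cast_mul, norm_mul]
    calc _ ≤ 1 * 1 := mul_le_mul hsgn hnorm (norm_nonneg _) zero_le_one
      _ = 1 := one_mul _
  have heq : algebraMap ℚ ℚ_[p] ((teichSign p w : ℚ) * q) =
      algebraMap ℤ_[p] ℚ_[p] ⟨(((teichSign p w : ℚ) * q : ℚ) : ℚ_[p]), hnorm'⟩ := by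
    rw [eq_ratCast]
    rfl
  rw [heq]
  exact C_mem_lifts _ _

omit [NeZero N] in
/-- Monic descent `ℚ_p[T] → ℤ_p[T]`. [folklore] -/
private theorem dvd_of_map_dvd_map' {D P : ℤ_[p][X]} (hD : D.Monic)
    (h : D.map (algebraMap ℤ_[p] ℚ_[p]) ∣ P.map (algebraMap ℤ_[p] ℚ_[p])) : D ∣ P := by
  rw [← modByMonic_eq_zero_iff_dvd hD]
  apply Polynomial.map_injective (algebraMap ℤ_[p] ℚ_[p]) (IsFractionRing.injective ℤ_[p] ℚ_[p])
  rw [Polynomial.map_modByMonic _ hD, Polynomial.map_zero]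
  exact (modByMonic_eq_zero_iff_dvd (hD.map _)).mpr h

omit [NeZero N] in
/-- The two routes `ℤ[T] → ℚ[T] → ℚ_p[T]` and `ℤ[T] → ℤ_p[T] → ℚ_p[T]` agree. [folklore] -/
private theorem map_map_int_eq' (q : ℤ[X]) :
    (q.map (Int.castRingHom ℚ)).map (algebraMap ℚ ℚ_[p]) =
      (q.map (Int.castRingHom ℤ_[p])).map (algebraMap ℤ_[p] ℚ_[p]) := by
  rw [Polynomial.map_map, Polynomial.map_map,
    RingHom.ext_int ((algebraMap ℚ ℚ_[p]).comp (Int.castRingHom ℚ))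
      ((algebraMap ℤ_[p] ℚ_[p]).comp (Int.castRingHom ℤ_[p]))]

omit [NeZero N] in
/-- Descent of a divisibility from `ℚ[T]` to `ℤ_p[T]`. [folklore] -/
private theorem map_dvd_of_dvd' {D : ℤ[X]} (hD : D.Monic) {P : ℚ[X]} {Θ : ℤ_[p][X]}
    (hΘ : Θ.map (algebraMap ℤ_[p] ℚ_[p]) = P.map (algebraMap ℚ ℚ_[p]))
    (h : D.map (Int.castRingHom ℚ) ∣ P) : D.map (Int.castRingHom ℤ_[p]) ∣ Θ := by
  refine dvd_of_map_dvd_map' (hD.map _) ?_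
  rw [← map_map_int_eq', hΘ]
  exact Polynomial.map_dvd _ h

omit [NeZero N] in
/-- The constant term of `Φ_{p^{k+1}}(1+T)` is `p`. [folklore] -/
private theorem dvd_coeff_zero_cyclotomic_comp' (k : ℕ) :
    (p : ℤ_[p]) ∣ (((cyclotomic (p ^ (k + 1)) ℤ).comp (X + 1)).map (Int.castRingHom ℤ_[p])).coeff 0 := by
  rw [coeff_map, coeff_zero_eq_eval_zero, eval_comp, eval_add, eval_X, eval_one, zero_add,
    eval_one_cyclotomic_prime_pow, map_natCast]

omit [NeZero N] [Fact p.Prime] in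
/-- The algebraic identity behind the congruence. [folklore] -/
private theorem sub_mul_eq_of_identities' {R : Type*} [CommRing R] {Θ Ωm Ωp B q g L Q Ω σ : R}
    (hσ : σ * σ = 1) (hΘ : Θ = Ωm * q) (hg : g = σ * q) (hL : L - g = B * Ωp * Q)
    (hΩ : Ω = B * Ωp * Ωm) : Θ - σ * Ωm * L = Ω * -(σ * Q) := by
  have hL' : L = g + B * Ωp * Q := by rw [← hL]; ring
  rw [hL', hg, hΘ, hΩ]
  linear_combination (-(Ωm * q)) * hσ

/-- **Existence of the quadratic-branch function** `M ∈ Λ = ℤ_p⟦T⟧` with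
`θ_{2m+1}(η) ≡ (−1)^{m+1} ω⁺_{2m+1} M (mod ω_{2m+1} Λ)` for every `m` (an identity in `Λ`, no `p`
inverted): `M = lim_m (−1)^{m+1} θ_{2m+1}(η)/ω⁺_{2m+1}` in `Λ = lim Λ/(T ω⁻_{2m+1})`. This `M` is
Kobayashi's `L_p⁻(E, η, X)` up to the period normalisation (Thm. 3.2 with (3.5): the odd levels carry
the factor `∏_{even k} Φ_k`). Port of the tree's `exists_isCongrModOmega_odd`.
[cite: Kobayashi2003, Thm. 3.2 and (3.5) (p. 7)] [cite: Pollack2003, Prop. 6.18] -/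
theorem exists_isCongrModOmega_quadraticBranch_odd (hp2 : p ≠ 2) (hf0 : IsNewform0 f)
    (hQ : coeffField f = ⊥) (hpN : ¬ p ∣ N) (hap : cuspCoeff f p = ((0 : ℤ) : ℂ)) :
    ∃ L : IwasawaAlgebra p, ∀ m : ℕ,
      IsCongrModOmega p (2 * m + 1) (quadraticBranchMazurTateElement p f (2 * m + 1))
        ((-1) ^ (m + 1) * cyclotomicOmegaPlus p (2 * m + 1)) L := by
  classical
  choose Θ hΘ using fun n ↦ exists_map_eq_map_quadraticBranchMazurTateElement hp2 hf0 hQ hpN hap n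
  set Ωm : ℕ → ℤ_[p][X] := fun k ↦ (cyclotomicOmegaMinus p k).map (Int.castRingHom ℤ_[p])
    with hΩm
  set Ωp : ℕ → ℤ_[p][X] := fun k ↦ (cyclotomicOmegaPlus p k).map (Int.castRingHom ℤ_[p])
    with hΩp
  have hmon : ∀ k, (Ωp k).Monic := fun k ↦ (monic_cyclotomicOmegaPlus p k).map _
  have hdiv : ∀ m, Ωp (2 * m + 1) ∣ Θ (2 * m + 1) := fun m ↦
    map_dvd_of_dvd' (monic_cyclotomicOmegaPlus p _) (hΘ _)
      (cyclotomicOmegaPlus_dvd_quadraticBranchMazurTateElement hf0 hQ hpN hap m)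
  set g : ℕ → ℤ_[p][X] := fun m ↦ (-1) ^ (m + 1) * (Θ (2 * m + 1) /ₘ Ωp (2 * m + 1)) with hg
  have hgmap : ∀ m, (g m).map (algebraMap ℤ_[p] ℚ_[p]) =
      ((-1) ^ (m + 1) * (quadraticBranchMazurTateElement p f (2 * m + 1) /ₘ
        (cyclotomicOmegaPlus p (2 * m + 1)).map (Int.castRingHom ℚ))).map (algebraMap ℚ ℚ_[p]) := by
    intro m
    rw [hg]
    dsimp only
    rw [Polynomial.map_mul, Polynomial.map_mul, Polynomial.map_pow, Polynomial.map_pow,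
      Polynomial.map_neg, Polynomial.map_neg, Polynomial.map_one, Polynomial.map_one,
      Polynomial.map_divByMonic _ (hmon _), Polynomial.map_divByMonic _
        ((monic_cyclotomicOmegaPlus p _).map _), hΘ, map_map_int_eq']
  have hcompat : ∀ m, X * Ωm (2 * m + 1) ∣ g (m + 1) - g m := by
    intro m
    have hD : (X * cyclotomicOmegaMinus p (2 * m + 1)).Monic :=
      monic_X.mul (monic_cyclotomicOmegaMinus p _)
    have h1 : (X * cyclotomicOmegaMinus p (2 * m + 1)).map (Int.castRingHom ℤ_[p]) =
        X * Ωm (2 * m + 1) := by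
      rw [Polynomial.map_mul, Polynomial.map_X]
    rw [← h1]
    refine dvd_of_map_dvd_map' (hD.map _) ?_
    rw [← map_map_int_eq', Polynomial.map_sub, hgmap, hgmap, ← Polynomial.map_sub,
      Polynomial.map_mul, Polynomial.map_X]
    exact Polynomial.map_dvd _ (X_mul_cyclotomicOmegaMinus_dvd_sub_quadraticBranch hf0 hQ hpN hap m)
  choose s hs using hcompat
  set B : ℤ_[p][X] := X * ((cyclotomic p ℤ).comp (X + 1)).map (Int.castRingHom ℤ_[p]) with hB
  set ξ : ℕ → ℤ_[p][X] := fun i ↦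
    ((cyclotomic (p ^ (2 * i + 3)) ℤ).comp (X + 1)).map (Int.castRingHom ℤ_[p]) with hξ
  have hξ0 : ∀ i, (p : ℤ_[p]) ∣ (ξ i).coeff 0 := fun i ↦ by
    rw [hξ]
    dsimp only
    rw [show 2 * i + 3 = (2 * i + 2) + 1 by ring]
    exact dvd_coeff_zero_cyclotomic_comp' _
  have hΩmξ : ∀ m, X * Ωm (2 * m + 1) = B * ∏ i ∈ Finset.range m, ξ i := fun m ↦ by
    rw [hΩm, hξ, hB]
    dsimp only
    rw [cyclotomicOmegaMinus_two_mul_add_one_eq_prod, Polynomial.map_mul, Polynomial.map_prod,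
      mul_assoc]
  obtain ⟨L, hL⟩ := exists_powerSeries_sub_eq_mul B ξ hξ0 g s fun M ↦ by rw [← hΩmξ, hs]
  refine ⟨L, fun m ↦ ?_⟩
  obtain ⟨Q, hLQ⟩ := hL m
  rw [← hΩmξ] at hLQ
  refine ⟨0, -((-1) ^ (m + 1) * Q), ?_⟩
  have hθ : (((quadraticBranchMazurTateElement p f (2 * m + 1)).map (algebraMap ℚ ℚ_[p]) : ℚ_[p][X]) :
      PowerSeries ℚ_[p]) = iwasawaToPowerSeries p (Θ (2 * m + 1) : PowerSeries ℤ_[p]) := by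
    rw [← hΘ, Polynomial.polynomial_map_coe]
  have hω : (((-1) ^ (m + 1) * cyclotomicOmegaPlus p (2 * m + 1)).map (Int.castRingHom ℤ_[p]) :
      PowerSeries ℤ_[p]) = (-1) ^ (m + 1) * (Ωp (2 * m + 1) : PowerSeries ℤ_[p]) := by
    rw [Polynomial.map_mul, Polynomial.map_pow, Polynomial.map_neg, Polynomial.map_one,
      Polynomial.coe_mul, Polynomial.coe_pow, Polynomial.coe_neg, Polynomial.coe_one]
  have hΩ : (((cyclotomicOmega p (2 * m + 1)).map (Int.castRingHom ℤ_[p]) : ℤ_[p][X]) :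
      PowerSeries ℤ_[p]) = ((X : ℤ_[p][X]) : PowerSeries ℤ_[p]) *
        (Ωm (2 * m + 1) : PowerSeries ℤ_[p]) * (Ωp (2 * m + 1) : PowerSeries ℤ_[p]) := by
    rw [← X_mul_cyclotomicOmegaPlus_mul_cyclotomicOmegaMinus, Polynomial.map_mul,
      Polynomial.map_mul, Polynomial.map_X, Polynomial.coe_mul, Polynomial.coe_mul]
    ring
  have hΘq : (Θ (2 * m + 1) : PowerSeries ℤ_[p]) = (Ωp (2 * m + 1) : PowerSeries ℤ_[p]) *
      ((Θ (2 * m + 1) /ₘ Ωp (2 * m + 1) : ℤ_[p][X]) : PowerSeries ℤ_[p]) := by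
    rw [← Polynomial.coe_mul, mul_divByMonic_eq_of_monic_of_dvd (hmon _) (hdiv m)]
  have hgq : (g m : PowerSeries ℤ_[p]) =
      (-1) ^ (m + 1) * ((Θ (2 * m + 1) /ₘ Ωp (2 * m + 1) : ℤ_[p][X]) : PowerSeries ℤ_[p]) := by
    rw [hg]
    dsimp only
    rw [Polynomial.coe_mul, Polynomial.coe_pow, Polynomial.coe_neg, Polynomial.coe_one]
  have hσ : ((-1 : PowerSeries ℤ_[p]) ^ (m + 1)) * (-1) ^ (m + 1) = 1 := by
    rw [← mul_pow, neg_one_mul, neg_neg, one_pow]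
  have hLQ' : L - (g m : PowerSeries ℤ_[p]) =
      ((X : ℤ_[p][X]) : PowerSeries ℤ_[p]) * (Ωm (2 * m + 1) : PowerSeries ℤ_[p]) * Q := by
    rw [← Polynomial.coe_mul]
    exact hLQ
  have key := sub_mul_eq_of_identities' hσ hΘq hgq hLQ' hΩ
  rw [pow_zero, map_one, one_mul, hθ, hω, ← map_sub, key]

end Construction

end Summit.BirchSwinnertonDyer.Rank1Residual.Additive

end
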